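import Summits.QuantumFields.BalabanUV.Beta.GAN24.TableDressingZeroMode
import Summits.QuantumFields.BalabanUV.Beta.GAN24.Push4Iter
import Summits.QuantumFields.BalabanUV.Beta.SpineRecursiveW

/-!
# `BalabanUV.Beta.GAN24.FourFaceDressedZeroMode` — binder row G-an2-4 ∕ (CONV-C), row (C) at the levels `j ≥ 1`, CONTACT side; Part 39 of
# `GAN24/FourFaceGaugeSectors`: **THE FOUR-FACE PIECE OF THE MEMBER ZERO MODE IS THE ZERO MODE OF THE LEG-DRESSED LOWER TABLE** — the bracket
# `FOURFACE_j(κ, κ′; α, β) = Σ_{r′ ∈ box, r′_κ exit} [ Σ'_{(x,z)} 𝟙_{exit α}(x)𝟙_{exit β}(z)·Σ'_{s′ exit_κ′} Y κ (toSite r′) κ′ s′ x z α β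
#   + Σ'_{(x,z)} 𝟙𝟙·Σ'_{t exit_κ′} Y κ′ t κ (toSite r′) x z α β ]` of Part 34 (`TransportWordCellSlot.sum_box_transport_T2RecAt_eq_fourFace`) and of
# Part 38's display (`QuarticMemberCellResolved.zmode_T2RecAt_succ_resolved`), read through leaf-02 g52's `TableDressingZeroMode.zmode_tableDress_ff`
# (`zmode N (𝔇 Y) = N⁴ · (four-face charge of Y)`, `𝔇` = `Πᵀ_bm` on both source slots and `Π_bm ∘ · ∘ Πᵀ_bm` on the legs — leaf-06 g42's
# `LinT2CoDressed.lin4_coDressKBmAt` table VERBATIM):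
#
#   `FOURFACE(Y)(κ, κ′; α, β) = N⁻⁴ · ( zmode N (𝔇 Y) κ κ′ (inl α) (inl β) + zmode N (𝔇 Yᵀ) κ κ′ (inl α) (inl β) )`,   `Yᵀ κ u κ′ u′ := Y κ′ u′ κ u`,
#
# for every `LocStencil₂`, jointly `N`-covariant table `Y` (in-block root, `1 ≤ N`), and its instance `Y = T2RecAt … j`, `N = Lc` (every `j`, any pins,
# jointly `LocStencil₂` jointly block-covariant zero-ff-block border, coarse-covariant `LocStencilFM` joint table — `SpineRooted.T2RecAt_loc ∕ _translate`).
# So the transport∕four-face piece of road-P2's member zero mode at level `j+1` is `Lc⁻⁴ ×` the zero mode of the LEG-DRESSED, slot-symmetrised level-`j`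
# member table — by g52 §4 (`zmode N (𝔇 Y − Y) = N⁴·fourFace − zmode N Y`) the level-`j` zero mode `zmode Lc (T2RecAt … j)` plus the zero mode of the
# dressing DEFECT: the recursion's lower-level letter, located.
#
# WHAT ([folklore] BY NAME: Fubini over g52's `summable_triple`, `Summable.tsum_comm`, `Summable.tsum_prod`, g52's `zmode_tableDress_ff` twice, leaf-17's
# `Push4Iter.locStencil₂_swapT` for `Yᵀ`, leaf-02 g15's `BiStencilZeroMode.tsum_eq_sum_box_tsum` (cell decomposition); 0 `def`, 0 cited facts, 0 `def … : Prop`, 0 sorry): `tsum3_face4_eq` (the four-mask triple series of a slice,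
# reorganised as Part 34 reads it), **`fourFace_eq_zmode_dress`** (generic `Y`), **`fourFace_T2RecAt_eq_zmode_dress`** (the member table; the left side is
# Part 38's `FOURFACE_j` bracket byte-for-byte); §3 **`fourFace_eq_zmode_add_defect`** ∕ **`fourFace_T2RecAt_eq_zmode_add_defect`** (the same with the
# lower table's OWN zero mode `zmode N Y` separated from the dressing-defect zero mode `zmode N (𝔇 Y − Y)`, g52 §4 — the recursion's lower-level letter).
# §4 **`zmode_transpose_of_cov`** ∕ **`zmode_T2RecAt_transpose`**: `zmode N Yᵀ κ κ′ = zmode N Y κ′ κ` (jointly covariant `LocStencil₂ Y`) — the transposed-table letters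
# of §2–§3 are road-P2's bond-swapped zero modes.
#
# HONEST: NOT IN PRINT — our bookkeeping over OUR typed comb objects; NO table, zero mode or four-face charge VALUED; NOTHING of (C) at j ≥ 1 ∕ `hX` ∕ `hSrc` ∕
# (C)sym ∕ (Q-L) ∕ (FL) ∕ (HC) ∕ «T2Shape» ∕ «T2Drift» ∕ (hW, hWall) discharged; NEVER «G-an2-4 closed» as (CONV-C); NOT D1, NOT `BetaPertH`, NOT continuum,
# NOT Clay.  HONEST DEPENDENCY: continuum YM on T⁴ ⇐ BetaPertH ∧ nine spine estimates (0/9 proved); BetaPertH ⇐ (D1) ∧ (D4) ∧ CAP+tail; G-an2-4 gates asym,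
# D1 and NE2/3/4.  G-an2-4 formalisation, leaf prover 02 (gen 67), 2026-08-24; no existing file touched.
-/

noncomputable section

open Finset
open scoped BigOperators
open Literature.MathematicalPhysics.QuantumFieldTheory
open Literature.MathematicalPhysics.QuantumFieldTheory.Balaban1983to89
open Literature.MathematicalPhysics.QuantumFieldTheory.Balaban1983to89.Beta
open ExpKernelCalculus (MKer shiftK)
open AffineAveraging (Site box toSite)
open OneStepResolventKernel (Fib)
open BalabanCompositeJets (LocStencil₂)
open SecondOrderResponse (LocStencilFM)
open Summit.QuantumFields.BalabanUV.Beta.AxialDressingRooted (coProjBmAtK dressKBmAt)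
open Summit.QuantumFields.BalabanUV.Beta.SpineRooted (T2RecAt T2RecAt_loc T2RecAt_translate)
open Summit.QuantumFields.BalabanUV.Beta.GAN24.BiStencilZeroMode (Tab zmode tsum_eq_sum_box_tsum)
open Summit.QuantumFields.BalabanUV.Beta.GAN24.TableDressingZeroMode (summable_ite_of_summable summable_triple zmode_tableDress_ff
  zmode_tableDress_sub_self_ff)
open Summit.QuantumFields.BalabanUV.Beta.GAN24.Push4Iter (locStencil₂_swapT)

namespace Summit.QuantumFields.BalabanUV.Beta.GAN24.FourFaceDressedZeroMode

variable {d : ℕ} {N : ℕ} {r : Fin (d + 1) → ℕ}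

/-! ## §1 The four-mask triple series of a slice, reorganised -/

/-- NOT IN PRINT; OUR BOOKKEEPING.  For a `LocStencil₂` table `Y` (rate `δ > 0`), one slot pair `(κ,u;κ′)`, a constant condition `Q` and face masks on
the second bond and the two legs: `Σ'_{u′} Σ'_x Σ'_z [Q ∧ u′_{κ′} ∧ x_a ∧ z_b] Y κ u κ′ u′ x z a b = [Q]·Σ'_{(x,z)} 𝟙_a(x)𝟙_b(z)·Σ'_{u′} [u′_{κ′}] Y κ u κ′ u′ x z a b`
(Fubini over g52's `summable_triple`). -/
theorem tsum3_face4_eq {Y : Tab d} {C δ : ℝ} (hY : LocStencil₂ Y C δ) (hδ : 0 < δ) (κ : Fin (d + 1)) (u : Site (d + 1)) (κ' : Fin (d + 1))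
    (Q : Prop) [Decidable Q] (a b : Fin (d + 1)) :
    ∑' u' : Site (d + 1), ∑' x : Site (d + 1), ∑' z : Site (d + 1),
        (if Q ∧ u' κ' % (N : ℤ) = (N : ℤ) - 1 ∧ x a % (N : ℤ) = (N : ℤ) - 1 ∧ z b % (N : ℤ) = (N : ℤ) - 1
          then Y κ u κ' u' x z (Sum.inl a) (Sum.inl b) else 0)
      = if Q then ∑' xz : Site (d + 1) × Site (d + 1), (if xz.1 a % (N : ℤ) = (N : ℤ) - 1 then (1 : ℝ) else 0) * (if xz.2 b % (N : ℤ) = (N : ℤ) - 1 then (1 : ℝ) else 0) *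
          ∑' u' : Site (d + 1), (if u' κ' % (N : ℤ) = (N : ℤ) - 1 then Y κ u κ' u' xz.1 xz.2 (Sum.inl a) (Sum.inl b) else 0) else 0 := by
  by_cases hQ : Q
  · simp only [hQ, true_and, if_true]
    -- the masked slice as ONE summable family on `u′ × (x × z)`
    set F : Site (d + 1) × (Site (d + 1) × Site (d + 1)) → ℝ := fun p =>
      if p.1 κ' % (N : ℤ) = (N : ℤ) - 1 ∧ p.2.1 a % (N : ℤ) = (N : ℤ) - 1 ∧ p.2.2 b % (N : ℤ) = (N : ℤ) - 1
        then Y κ u κ' p.1 p.2.1 p.2.2 (Sum.inl a) (Sum.inl b) else 0 with hF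
    have hFs : Summable F := summable_ite_of_summable (summable_triple hY hδ κ u κ' (Sum.inl a) (Sum.inl b)) _
    -- the two inner series are the product series
    have e1 : ∀ u' : Site (d + 1), (∑' x : Site (d + 1), ∑' z : Site (d + 1),
        (if u' κ' % (N : ℤ) = (N : ℤ) - 1 ∧ x a % (N : ℤ) = (N : ℤ) - 1 ∧ z b % (N : ℤ) = (N : ℤ) - 1
          then Y κ u κ' u' x z (Sum.inl a) (Sum.inl b) else 0))
        = ∑' xz : Site (d + 1) × Site (d + 1), F (u', xz) := fun u' => ((hFs.prod_factor u').tsum_prod).symm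
    rw [tsum_congr e1]
    -- swap `u′` and `(x,z)`
    have hFs' : Summable (Function.uncurry fun (xz : Site (d + 1) × Site (d + 1)) (u' : Site (d + 1)) => F (u', xz)) :=
      ((Equiv.prodComm (Site (d + 1) × Site (d + 1)) (Site (d + 1))).summable_iff (f := F)).2 hFs
    rw [Summable.tsum_comm hFs']
    refine tsum_congr fun xz => ?_
    by_cases hx : xz.1 a % (N : ℤ) = (N : ℤ) - 1
    · by_cases hz : xz.2 b % (N : ℤ) = (N : ℤ) - 1
      · rw [if_pos hx, if_pos hz, one_mul, one_mul]
        exact tsum_congr fun u' => by simp only [hF, hx, hz, and_true]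
      · rw [if_neg hz, mul_zero, zero_mul]
        exact (tsum_congr fun u' => by simp only [hF, hz, and_false, if_false]).trans tsum_zero
    · rw [if_neg hx, zero_mul, zero_mul]
      exact (tsum_congr fun u' => by simp only [hF, hx, false_and, and_false, if_false]).trans tsum_zero
  · simp only [hQ, false_and, if_false, tsum_zero]

/-! ## §2 The four-face bracket is the zero mode of the leg-dressed, slot-symmetrised table -/

/-- NOT IN PRINT; OUR BOOKKEEPING — **`FOURFACE(Y) = N⁻⁴·(zmode N (𝔇 Y) + zmode N (𝔇 Yᵀ))`** for a `LocStencil₂`, jointly `N`-covariant table `Y`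
(in-block root `toSite r`, `1 ≤ N`; `𝔇` = g52's leg dressing, written out; `Yᵀ κ u κ′ u′ = Y κ′ u′ κ u`, a `LocStencil₂` family at a third of the rate by
`Push4Iter.locStencil₂_swapT`).  The left side is Part 34's four-face bracket (both slot orders) for the generic table. -/
theorem fourFace_eq_zmode_dress (hN : 1 ≤ N) (hr : r ∈ box (d + 1) N) {Y : Tab d} {C δ : ℝ} (hY : LocStencil₂ Y C δ) (hδ : 0 < δ)
    (hcov : ∀ κ u κ' u' t, Y κ (u + (N : ℤ) • t) κ' (u' + (N : ℤ) • t) = shiftK (-((N : ℤ) • t)) (Y κ u κ' u'))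
    (κ κ' a b : Fin (d + 1)) :
    ∑ rr ∈ box (d + 1) N, (if toSite rr κ % (N : ℤ) = (N : ℤ) - 1 then
        (∑' xz : Site (d + 1) × Site (d + 1), (if xz.1 a % (N : ℤ) = (N : ℤ) - 1 then (1 : ℝ) else 0) * (if xz.2 b % (N : ℤ) = (N : ℤ) - 1 then (1 : ℝ) else 0) * ∑' s' : Site (d + 1),
            (if s' κ' % (N : ℤ) = (N : ℤ) - 1 then Y κ (toSite rr) κ' s' xz.1 xz.2 (Sum.inl a) (Sum.inl b) else 0))
        + ∑' xz : Site (d + 1) × Site (d + 1), (if xz.1 a % (N : ℤ) = (N : ℤ) - 1 then (1 : ℝ) else 0) * (if xz.2 b % (N : ℤ) = (N : ℤ) - 1 then (1 : ℝ) else 0) * ∑' t : Site (d + 1),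
            (if t κ' % (N : ℤ) = (N : ℤ) - 1 then Y κ' t κ (toSite rr) xz.1 xz.2 (Sum.inl a) (Sum.inl b) else 0)
        else 0)
      = ((N : ℝ) ^ 4)⁻¹ *
        (zmode N (fun κ u κ' u' => dressKBmAt (toSite r) N
            (coProjBmAtK (toSite r) N (fun κ₁ u₁ => coProjBmAtK (toSite r) N (Y κ₁ u₁) κ' u') κ u)) κ κ' (Sum.inl a) (Sum.inl b)
        + zmode N (fun κ u κ' u' => dressKBmAt (toSite r) N
            (coProjBmAtK (toSite r) N (fun κ₁ u₁ => coProjBmAtK (toSite r) N (fun κ₂ u₂ => Y κ₂ u₂ κ₁ u₁) κ' u') κ u)) κ κ' (Sum.inl a) (Sum.inl b)) := by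
  have hYT : LocStencil₂ (fun κ₁ u₁ κ₂ u₂ => Y κ₂ u₂ κ₁ u₁) C (δ / 3) := locStencil₂_swapT hY hδ.le
  have hδ3 : 0 < δ / 3 := by positivity
  have hcovT : ∀ κ u κ' u' t, (fun κ₁ u₁ κ₂ u₂ => Y κ₂ u₂ κ₁ u₁) κ (u + (N : ℤ) • t) κ' (u' + (N : ℤ) • t)
      = shiftK (-((N : ℤ) • t)) ((fun κ₁ u₁ κ₂ u₂ => Y κ₂ u₂ κ₁ u₁) κ u κ' u') := fun κ u κ' u' t => hcov κ' u' κ u t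
  have hN4 : ((N : ℝ) ^ 4)⁻¹ * (N : ℝ) ^ 4 = 1 := inv_mul_cancel₀ (by positivity)
  rw [zmode_tableDress_ff hN hr hY hδ hcov κ κ' a b, zmode_tableDress_ff hN hr hYT hδ3 hcovT κ κ' a b,
    Finset.sum_congr rfl fun rr _ => tsum3_face4_eq hY hδ κ (toSite rr) κ' (toSite rr κ % (N : ℤ) = (N : ℤ) - 1) a b,
    Finset.sum_congr rfl fun rr _ => tsum3_face4_eq (Y := fun κ₁ u₁ κ₂ u₂ => Y κ₂ u₂ κ₁ u₁) hYT hδ3 κ (toSite rr) κ' (toSite rr κ % (N : ℤ) = (N : ℤ) - 1) a b,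
    ← mul_add, ← mul_assoc, hN4, one_mul, ← Finset.sum_add_distrib]
  exact Finset.sum_congr rfl fun rr _ => by split_ifs <;> simp

variable {Lc : ℕ} [NeZero Lc]

/-- NOT IN PRINT; OUR BOOKKEEPING — **THE FOUR-FACE PIECE OF ROAD-P2's MEMBER ZERO MODE IS THE ZERO MODE OF THE LEG-DRESSED LOWER MEMBER TABLE**: the
`FOURFACE_j` bracket of Part 38's display (`QuarticMemberCellResolved.zmode_T2RecAt_succ_resolved`; byte-for-byte its `Σ_{r′ ∈ box} (if … then … + … else 0)`)
equals `Lc⁻⁴·( zmode Lc (𝔇 T2RecAt_j) κ κ′ (inl α) (inl β) + zmode Lc (𝔇 (T2RecAt_j)ᵀ) κ κ′ (inl α) (inl β) )` — every `j`, in-block root, `1 ≤ Lc`, ANY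
pins; `vh₂S` a jointly `LocStencil₂`, jointly block-covariant border, `mixFF` a coarse-covariant `LocStencilFM` table (`SpineRooted.T2RecAt_loc ∕ _translate`).
With g52 §4, `zmode Lc (𝔇 Y) = zmode Lc (𝔇 Y − Y) + zmode Lc Y`: the level-`j` zero mode and the zero mode of the dressing defect — nothing valued. -/
theorem fourFace_T2RecAt_eq_zmode_dress (hLc : 1 ≤ Lc) (hr : r ∈ box (d + 1) Lc) (cE cVH cΛ cE₂ cB : ℝ) (T : Fin 4 → Fin 4 → Fin 4 → Fin 4 → ℝ)
    {vh₂S : Fin (d + 1) → Site (d + 1) → Fin (d + 1) → Site (d + 1) → MKer (d + 1) (Fib d)} (hB : ∃ C δ : ℝ, 0 < δ ∧ LocStencil₂ vh₂S C δ)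
    (hBt : ∀ (κ : Fin (d + 1)) (u : Site (d + 1)) (κ' : Fin (d + 1)) (u' t : Site (d + 1)),
      vh₂S κ (u + (Lc : ℤ) • t) κ' (u' + (Lc : ℤ) • t) = shiftK (-((Lc : ℤ) • t)) (vh₂S κ u κ' u'))
    {mixFF : Fin (d + 1) → Site (d + 1) → Fin (d + 1) → Site (d + 1) → MKer (d + 1) (Fib d)} (hmix : ∃ C δ : ℝ, 0 < δ ∧ LocStencilFM Lc mixFF C δ)
    (hmixt : ∀ (κ : Fin (d + 1)) (u : Site (d + 1)) (μ : Fin (d + 1)) (w t : Site (d + 1)), mixFF κ (u + (Lc : ℤ) • t) μ (w + t) = shiftK (-((Lc : ℤ) • t)) (mixFF κ u μ w))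
    (j : ℕ) (κ κ' α β : Fin (d + 1)) :
    ∑ rr ∈ box (d + 1) Lc, (if toSite rr κ % (Lc : ℤ) = (Lc : ℤ) - 1 then
        (∑' xz : Site (d + 1) × Site (d + 1), (if xz.1 α % (Lc : ℤ) = (Lc : ℤ) - 1 then (1 : ℝ) else 0) * (if xz.2 β % (Lc : ℤ) = (Lc : ℤ) - 1 then (1 : ℝ) else 0) * ∑' s' : Site (d + 1),
            (if s' κ' % (Lc : ℤ) = (Lc : ℤ) - 1 then T2RecAt d Lc (toSite r) cE cVH cΛ cE₂ cB T vh₂S mixFF j κ (toSite rr) κ' s' xz.1 xz.2 (Sum.inl α) (Sum.inl β) else 0))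
        + ∑' xz : Site (d + 1) × Site (d + 1), (if xz.1 α % (Lc : ℤ) = (Lc : ℤ) - 1 then (1 : ℝ) else 0) * (if xz.2 β % (Lc : ℤ) = (Lc : ℤ) - 1 then (1 : ℝ) else 0) * ∑' t : Site (d + 1),
            (if t κ' % (Lc : ℤ) = (Lc : ℤ) - 1 then T2RecAt d Lc (toSite r) cE cVH cΛ cE₂ cB T vh₂S mixFF j κ' t κ (toSite rr) xz.1 xz.2 (Sum.inl α) (Sum.inl β) else 0)
        else 0)
      = ((Lc : ℝ) ^ 4)⁻¹ *
        (zmode Lc (fun κ u κ' u' => dressKBmAt (toSite r) Lc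
            (coProjBmAtK (toSite r) Lc (fun κ₁ u₁ => coProjBmAtK (toSite r) Lc (T2RecAt d Lc (toSite r) cE cVH cΛ cE₂ cB T vh₂S mixFF j κ₁ u₁) κ' u') κ u))
            κ κ' (Sum.inl α) (Sum.inl β)
        + zmode Lc (fun κ u κ' u' => dressKBmAt (toSite r) Lc
            (coProjBmAtK (toSite r) Lc (fun κ₁ u₁ => coProjBmAtK (toSite r) Lc
              (fun κ₂ u₂ => T2RecAt d Lc (toSite r) cE cVH cΛ cE₂ cB T vh₂S mixFF j κ₂ u₂ κ₁ u₁) κ' u') κ u)) κ κ' (Sum.inl α) (Sum.inl β)) := by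
  obtain ⟨C₂, δ₂, hδ₂, hT⟩ := T2RecAt_loc cE cVH cΛ cE₂ cB T vh₂S mixFF hLc hr hB hmix j
  exact fourFace_eq_zmode_dress hLc hr hT hδ₂ (T2RecAt_translate (ρ := toSite r) cE cVH cΛ cE₂ cB T vh₂S mixFF hLc hBt hmixt j) κ κ' α β

/-! ## §3 The same, with the lower table's own zero mode separated from the dressing defect (g52 §4) -/

/-- NOT IN PRINT; OUR BOOKKEEPING — **`FOURFACE(Y) = N⁻⁴·( [zmode N (𝔇 Y − Y) + zmode N Y] + [zmode N (𝔇 Yᵀ − Yᵀ) + zmode N Yᵀ] )`** (generic `Y` as in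
`fourFace_eq_zmode_dress`; g52's `zmode_tableDress_sub_self_ff` twice): the LOWER table's own zero mode `zmode N Y` (both slot orders) and the zero modes
of the two dressing DEFECTS, separated. -/
theorem fourFace_eq_zmode_add_defect (hN : 1 ≤ N) (hr : r ∈ box (d + 1) N) {Y : Tab d} {C δ : ℝ} (hY : LocStencil₂ Y C δ) (hδ : 0 < δ)
    (hcov : ∀ κ u κ' u' t, Y κ (u + (N : ℤ) • t) κ' (u' + (N : ℤ) • t) = shiftK (-((N : ℤ) • t)) (Y κ u κ' u'))
    (κ κ' a b : Fin (d + 1)) :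
    ∑ rr ∈ box (d + 1) N, (if toSite rr κ % (N : ℤ) = (N : ℤ) - 1 then
        (∑' xz : Site (d + 1) × Site (d + 1), (if xz.1 a % (N : ℤ) = (N : ℤ) - 1 then (1 : ℝ) else 0) * (if xz.2 b % (N : ℤ) = (N : ℤ) - 1 then (1 : ℝ) else 0) * ∑' s' : Site (d + 1),
            (if s' κ' % (N : ℤ) = (N : ℤ) - 1 then Y κ (toSite rr) κ' s' xz.1 xz.2 (Sum.inl a) (Sum.inl b) else 0))
        + ∑' xz : Site (d + 1) × Site (d + 1), (if xz.1 a % (N : ℤ) = (N : ℤ) - 1 then (1 : ℝ) else 0) * (if xz.2 b % (N : ℤ) = (N : ℤ) - 1 then (1 : ℝ) else 0) * ∑' t : Site (d + 1),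
            (if t κ' % (N : ℤ) = (N : ℤ) - 1 then Y κ' t κ (toSite rr) xz.1 xz.2 (Sum.inl a) (Sum.inl b) else 0)
        else 0)
      = ((N : ℝ) ^ 4)⁻¹ *
        ((zmode N (fun κ u κ' u' => dressKBmAt (toSite r) N
            (coProjBmAtK (toSite r) N (fun κ₁ u₁ => coProjBmAtK (toSite r) N (Y κ₁ u₁) κ' u') κ u) - Y κ u κ' u') κ κ' (Sum.inl a) (Sum.inl b)
          + zmode N Y κ κ' (Sum.inl a) (Sum.inl b))
        + (zmode N (fun κ u κ' u' => dressKBmAt (toSite r) N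
            (coProjBmAtK (toSite r) N (fun κ₁ u₁ => coProjBmAtK (toSite r) N (fun κ₂ u₂ => Y κ₂ u₂ κ₁ u₁) κ' u') κ u) - Y κ' u' κ u) κ κ' (Sum.inl a) (Sum.inl b)
          + zmode N (fun κ₁ u₁ κ₂ u₂ => Y κ₂ u₂ κ₁ u₁) κ κ' (Sum.inl a) (Sum.inl b))) := by
  have hYT : LocStencil₂ (fun κ₁ u₁ κ₂ u₂ => Y κ₂ u₂ κ₁ u₁) C (δ / 3) := locStencil₂_swapT hY hδ.le
  have hδ3 : 0 < δ / 3 := by positivity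
  have hcovT : ∀ κ u κ' u' t, (fun κ₁ u₁ κ₂ u₂ => Y κ₂ u₂ κ₁ u₁) κ (u + (N : ℤ) • t) κ' (u' + (N : ℤ) • t)
      = shiftK (-((N : ℤ) • t)) ((fun κ₁ u₁ κ₂ u₂ => Y κ₂ u₂ κ₁ u₁) κ u κ' u') := fun κ u κ' u' t => hcov κ' u' κ u t
  rw [fourFace_eq_zmode_dress hN hr hY hδ hcov κ κ' a b, zmode_tableDress_sub_self_ff hN hr hY hδ hcov κ κ' a b,
    zmode_tableDress_sub_self_ff hN hr hYT hδ3 hcovT κ κ' a b, zmode_tableDress_ff hN hr hY hδ hcov κ κ' a b,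
    zmode_tableDress_ff hN hr hYT hδ3 hcovT κ κ' a b]
  ring

/-- NOT IN PRINT; OUR BOOKKEEPING — **THE LOWER MEMBER'S OWN ZERO MODE INSIDE THE UPPER ONE**: Part 38's `FOURFACE_j` bracket equals
`Lc⁻⁴·( [zmode Lc (𝔇 T2RecAt_j − T2RecAt_j) + zmode Lc T2RecAt_j] + [the same for (T2RecAt_j)ᵀ] ) κ κ′ (inl α) (inl β)` — road-P2's level-`j` zero mode
`zmode Lc (T2RecAt … j) κ κ′ (inl α) (inl β)` (and its slot transpose) located inside `zmode Lc (T2RecAt … (j+1))` with, by Part 38, the coefficient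
`−½·(cE₂·wV4 (j+1))·(−cH_j²)·|box|·cH_j²·Lc⁻⁴`; the rest is the pair form, leaf-04's response words and the two dressing-defect zero modes.  Nothing valued. -/
theorem fourFace_T2RecAt_eq_zmode_add_defect (hLc : 1 ≤ Lc) (hr : r ∈ box (d + 1) Lc) (cE cVH cΛ cE₂ cB : ℝ) (T : Fin 4 → Fin 4 → Fin 4 → Fin 4 → ℝ)
    {vh₂S : Fin (d + 1) → Site (d + 1) → Fin (d + 1) → Site (d + 1) → MKer (d + 1) (Fib d)} (hB : ∃ C δ : ℝ, 0 < δ ∧ LocStencil₂ vh₂S C δ)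
    (hBt : ∀ (κ : Fin (d + 1)) (u : Site (d + 1)) (κ' : Fin (d + 1)) (u' t : Site (d + 1)),
      vh₂S κ (u + (Lc : ℤ) • t) κ' (u' + (Lc : ℤ) • t) = shiftK (-((Lc : ℤ) • t)) (vh₂S κ u κ' u'))
    {mixFF : Fin (d + 1) → Site (d + 1) → Fin (d + 1) → Site (d + 1) → MKer (d + 1) (Fib d)} (hmix : ∃ C δ : ℝ, 0 < δ ∧ LocStencilFM Lc mixFF C δ)
    (hmixt : ∀ (κ : Fin (d + 1)) (u : Site (d + 1)) (μ : Fin (d + 1)) (w t : Site (d + 1)), mixFF κ (u + (Lc : ℤ) • t) μ (w + t) = shiftK (-((Lc : ℤ) • t)) (mixFF κ u μ w))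
    (j : ℕ) (κ κ' α β : Fin (d + 1)) :
    ∑ rr ∈ box (d + 1) Lc, (if toSite rr κ % (Lc : ℤ) = (Lc : ℤ) - 1 then
        (∑' xz : Site (d + 1) × Site (d + 1), (if xz.1 α % (Lc : ℤ) = (Lc : ℤ) - 1 then (1 : ℝ) else 0) * (if xz.2 β % (Lc : ℤ) = (Lc : ℤ) - 1 then (1 : ℝ) else 0) * ∑' s' : Site (d + 1),
            (if s' κ' % (Lc : ℤ) = (Lc : ℤ) - 1 then T2RecAt d Lc (toSite r) cE cVH cΛ cE₂ cB T vh₂S mixFF j κ (toSite rr) κ' s' xz.1 xz.2 (Sum.inl α) (Sum.inl β) else 0))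
        + ∑' xz : Site (d + 1) × Site (d + 1), (if xz.1 α % (Lc : ℤ) = (Lc : ℤ) - 1 then (1 : ℝ) else 0) * (if xz.2 β % (Lc : ℤ) = (Lc : ℤ) - 1 then (1 : ℝ) else 0) * ∑' t : Site (d + 1),
            (if t κ' % (Lc : ℤ) = (Lc : ℤ) - 1 then T2RecAt d Lc (toSite r) cE cVH cΛ cE₂ cB T vh₂S mixFF j κ' t κ (toSite rr) xz.1 xz.2 (Sum.inl α) (Sum.inl β) else 0)
        else 0)
      = ((Lc : ℝ) ^ 4)⁻¹ *
        ((zmode Lc (fun κ u κ' u' => dressKBmAt (toSite r) Lc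
            (coProjBmAtK (toSite r) Lc (fun κ₁ u₁ => coProjBmAtK (toSite r) Lc (T2RecAt d Lc (toSite r) cE cVH cΛ cE₂ cB T vh₂S mixFF j κ₁ u₁) κ' u') κ u)
            - T2RecAt d Lc (toSite r) cE cVH cΛ cE₂ cB T vh₂S mixFF j κ u κ' u') κ κ' (Sum.inl α) (Sum.inl β)
          + zmode Lc (T2RecAt d Lc (toSite r) cE cVH cΛ cE₂ cB T vh₂S mixFF j) κ κ' (Sum.inl α) (Sum.inl β))
        + (zmode Lc (fun κ u κ' u' => dressKBmAt (toSite r) Lc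
            (coProjBmAtK (toSite r) Lc (fun κ₁ u₁ => coProjBmAtK (toSite r) Lc
              (fun κ₂ u₂ => T2RecAt d Lc (toSite r) cE cVH cΛ cE₂ cB T vh₂S mixFF j κ₂ u₂ κ₁ u₁) κ' u') κ u)
            - T2RecAt d Lc (toSite r) cE cVH cΛ cE₂ cB T vh₂S mixFF j κ' u' κ u) κ κ' (Sum.inl α) (Sum.inl β)
          + zmode Lc (fun κ₁ u₁ κ₂ u₂ => T2RecAt d Lc (toSite r) cE cVH cΛ cE₂ cB T vh₂S mixFF j κ₂ u₂ κ₁ u₁) κ κ' (Sum.inl α) (Sum.inl β))) := by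
  obtain ⟨C₂, δ₂, hδ₂, hT⟩ := T2RecAt_loc cE cVH cΛ cE₂ cB T vh₂S mixFF hLc hr hB hmix j
  exact fourFace_eq_zmode_add_defect hLc hr hT hδ₂ (T2RecAt_translate (ρ := toSite r) cE cVH cΛ cE₂ cB T vh₂S mixFF hLc hBt hmixt j) κ κ' α β

/-! ## §4 The slot-transposed table has the slot-transposed zero mode -/

/-- NOT IN PRINT; OUR BOOKKEEPING — **`zmode N Yᵀ κ κ′ = zmode N Y κ′ κ`** for a `LocStencil₂`, jointly `N`-covariant table (cell decomposition of the free
second bond of `Yᵀ` = first bond of `Y`, joint covariance to move the cell restriction onto it, shift-invariance of the two leg series, and the reversed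
cell decomposition; summability from g52's `summable_triple` on `Y` and on `Yᵀ` via `locStencil₂_swapT`).  So §2–§3's `zmode N (… Yᵀ …)`-letters of the
UNDRESSED transposed table are road-P2's bond-swapped zero modes `zmode N Y κ′ κ`. -/
theorem zmode_transpose_of_cov [NeZero N] {Y : Tab d} {C δ : ℝ} (hY : LocStencil₂ Y C δ) (hδ : 0 < δ)
    (hcov : ∀ κ u κ' u' t, Y κ (u + (N : ℤ) • t) κ' (u' + (N : ℤ) • t) = shiftK (-((N : ℤ) • t)) (Y κ u κ' u'))
    (κ κ' : Fin (d + 1)) (a b : Fib d) :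
    zmode N (fun κ₁ u₁ κ₂ u₂ => Y κ₂ u₂ κ₁ u₁) κ κ' a b = zmode N Y κ' κ a b := by
  have hYT : LocStencil₂ (fun κ₁ u₁ κ₂ u₂ => Y κ₂ u₂ κ₁ u₁) C (δ / 3) := locStencil₂_swapT hY hδ.le
  have hδ3 : 0 < δ / 3 := by positivity
  -- the leg double series of one entry, as a function of the two bonds
  set G : Site (d + 1) → Site (d + 1) → ℝ := fun v s => ∑' x : Site (d + 1), ∑' z : Site (d + 1), Y κ' v κ s x z a b with hG
  -- summable in the second bond (slice of `Y`) and in the first bond (slice of `Yᵀ`)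
  have hGs : ∀ v : Site (d + 1), Summable fun s => G v s := by
    intro v
    have h3 := summable_triple hY hδ κ' v κ a b
    exact h3.prod.congr fun s => (h3.prod_factor s).tsum_prod
  have hGv : ∀ s : Site (d + 1), Summable fun v => G v s := by
    intro s
    have h3 := summable_triple hYT hδ3 κ s κ' a b
    exact h3.prod.congr fun v => (h3.prod_factor v).tsum_prod
  -- joint covariance read on `G`: moving both bonds by `N•t` does not change the leg double series
  have hGcov : ∀ v s t : Site (d + 1), G (v + (N : ℤ) • t) (s + (N : ℤ) • t) = G v s := by
    intro v s t
    have step : ∀ F : Site (d + 1) → ℝ, ∑' y : Site (d + 1), F (y + -((N : ℤ) • t)) = ∑' y : Site (d + 1), F y :=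
      fun F => (Equiv.addRight (-((N : ℤ) • t))).tsum_eq F
    simp only [hG, hcov κ' v κ s t, shiftK]
    rw [step (fun x => ∑' z : Site (d + 1), Y κ' v κ s x (z + -((N : ℤ) • t)) a b)]
    exact tsum_congr fun x => step (fun z => Y κ' v κ s x z a b)
  -- both sides as double cell sums of `G`
  show ∑ rr ∈ box (d + 1) N, ∑' v : Site (d + 1), G v (toSite rr) = ∑ rr ∈ box (d + 1) N, ∑' s : Site (d + 1), G (toSite rr) s
  have eL : ∀ rr : Fin (d + 1) → ℕ, ∑' v : Site (d + 1), G v (toSite rr)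
      = ∑ r₂ ∈ box (d + 1) N, ∑' t : Site (d + 1), G (toSite r₂) (toSite rr + (N : ℤ) • (-t)) := by
    intro rr
    rw [tsum_eq_sum_box_tsum (N := N) (hGv (toSite rr))]
    refine Finset.sum_congr rfl fun r₂ _ => tsum_congr fun t => ?_
    have h := hGcov (toSite r₂) (toSite rr + (N : ℤ) • (-t)) t
    rw [add_assoc, smul_neg, neg_add_cancel, add_zero, add_comm] at h
    rw [smul_neg]
    exact h
  have eR : ∀ r₂ : Fin (d + 1) → ℕ, ∑' s : Site (d + 1), G (toSite r₂) s
      = ∑ rr ∈ box (d + 1) N, ∑' t : Site (d + 1), G (toSite r₂) (toSite rr + (N : ℤ) • (-t)) := by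
    intro r₂
    rw [tsum_eq_sum_box_tsum (N := N) (hGs (toSite r₂))]
    refine Finset.sum_congr rfl fun rr _ => ?_
    rw [← (Equiv.neg (Site (d + 1))).tsum_eq (fun t => G (toSite r₂) (toSite rr + (N : ℤ) • (-t)))]
    exact tsum_congr fun t => by simp only [Equiv.neg_apply, neg_neg, add_comm]
  rw [Finset.sum_congr rfl fun rr _ => eL rr, Finset.sum_comm]
  exact Finset.sum_congr rfl fun r₂ _ => (eR r₂).symm

/-- NOT IN PRINT; OUR BOOKKEEPING — the instance `Y = T2RecAt … j`, `N = Lc`: the zero mode of the slot-transposed member table is road-P2's bond-swapped zero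
mode `zmode Lc (T2RecAt … j) κ′ κ a b` (every `j`, in-block root, `1 ≤ Lc`, any pins; border ∕ joint-table letters as in §2). -/
theorem zmode_T2RecAt_transpose (hLc : 1 ≤ Lc) (hr : r ∈ box (d + 1) Lc) (cE cVH cΛ cE₂ cB : ℝ) (T : Fin 4 → Fin 4 → Fin 4 → Fin 4 → ℝ)
    {vh₂S : Fin (d + 1) → Site (d + 1) → Fin (d + 1) → Site (d + 1) → MKer (d + 1) (Fib d)} (hB : ∃ C δ : ℝ, 0 < δ ∧ LocStencil₂ vh₂S C δ)
    (hBt : ∀ (κ : Fin (d + 1)) (u : Site (d + 1)) (κ' : Fin (d + 1)) (u' t : Site (d + 1)),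
      vh₂S κ (u + (Lc : ℤ) • t) κ' (u' + (Lc : ℤ) • t) = shiftK (-((Lc : ℤ) • t)) (vh₂S κ u κ' u'))
    {mixFF : Fin (d + 1) → Site (d + 1) → Fin (d + 1) → Site (d + 1) → MKer (d + 1) (Fib d)} (hmix : ∃ C δ : ℝ, 0 < δ ∧ LocStencilFM Lc mixFF C δ)
    (hmixt : ∀ (κ : Fin (d + 1)) (u : Site (d + 1)) (μ : Fin (d + 1)) (w t : Site (d + 1)), mixFF κ (u + (Lc : ℤ) • t) μ (w + t) = shiftK (-((Lc : ℤ) • t)) (mixFF κ u μ w))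
    (j : ℕ) (κ κ' : Fin (d + 1)) (a b : Fib d) :
    zmode Lc (fun κ₁ u₁ κ₂ u₂ => T2RecAt d Lc (toSite r) cE cVH cΛ cE₂ cB T vh₂S mixFF j κ₂ u₂ κ₁ u₁) κ κ' a b = zmode Lc (T2RecAt d Lc (toSite r) cE cVH cΛ cE₂ cB T vh₂S mixFF j) κ' κ a b := by
  obtain ⟨C₂, δ₂, hδ₂, hT⟩ := T2RecAt_loc cE cVH cΛ cE₂ cB T vh₂S mixFF hLc hr hB hmix j
  exact zmode_transpose_of_cov hT hδ₂ (T2RecAt_translate (ρ := toSite r) cE cVH cΛ cE₂ cB T vh₂S mixFF hLc hBt hmixt j) κ κ' a b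

end Summit.QuantumFields.BalabanUV.Beta.GAN24.FourFaceDressedZeroMode

end
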